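import Summits.AtomisticToContinuum.BoseEinsteinCondensation.Theorems.PeriodicIRBound.Negative.TwoModeStates

/-!
# Negative lemmas for crux `PeriodicIRBound` (stmt-AtomisticToContinuum-3972), II: load-bearing
hypotheses and quantifier order

Supports (does not close) stmt-AtomisticToContinuum-3972, route `BECGroundStateSOS`. Landed copy of
§5–§8 of `Cruxes/PeriodicIRBound/Disproof.lean` (cycle 1); all `sorry`-free.

* §5 `periodicIRBound_false_without_nearMin` — drop "`Ψ` is a `δ`-near-minimiser": false for every
  admissible `v` (boosted condensate `n_{e₁} = N`).
* §6 `periodicIRBound_false_without_finiteRange` — weaken admissibility to `Measurable v`: false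
  (`v ≡ 1`, `E₀^{per} = ⊤`). Finite range is used only through `E₀^{per}(N, L_N) < ⊤`.
* §7 `periodicIRBound_false_allDensities` — `∀ ρ > 0` in place of `ρ < ρ₀(v)`: false for the admissible
  hard core of radius `1` at `ρ = 64` (jamming).
* §8 `periodicIRBound_false_uniformSlack` — `∃ δ > 0, ∀ᶠ N` in place of `∀ᶠ N, ∃ δ > 0`: FALSE ALREADY
  FOR THE FREE GAS (the window admits `twoMode t`, `t = min(δ,1)L_N²/(4π²N)`, with
  `n_{e₁} = min(δ,1)L_N²/4π² ≫ C√ρL_N`): the crux is a ground-state statement, not an energy-window one.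
-/

noncomputable section

open MeasureTheory Filter
open scoped ENNReal NNReal ComplexConjugate BigOperators
namespace Summit.AtomisticToContinuum.BoseEinsteinCondensation.Theorems.PeriodicIRBound.Negative

open Literature.MathematicalPhysics.QuantumManyBody.BoseGas
open Summit.AtomisticToContinuum.BoseEinsteinCondensation.Theses.BECGroundStateSOS
open Summit.AtomisticToContinuum.BoseEinsteinCondensation.Theorems.GaussianDominationCan.Negative
  (symState symFun oneBody periodicEnergy_symState nsq nsq_nonneg e0 e0_ne_zero norm_e0
    nsq_e0 one_le_norm_intVec lintegral_nnnorm_sq_prodFun lintegral_nnnorm_sq_oneBody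
    continuous_oneBody integral_cell_const conj_cellWave_mul_self integral_cell_conj_cellWave
    isRepulsiveFiniteRange_zero)
open Summit.AtomisticToContinuum.BoseEinsteinCondensation.Theorems.GaussianDominationCan.Negative
  renaming prodFun → gdProd
open Summit.AtomisticToContinuum.BoseEinsteinCondensation.Theorems.CorrectorClosure.Negative
  (hardCore isRepulsiveFiniteRange_hardCore periodicEnergy_hardCore_eq_top
    periodicGroundStateEnergy_one_eq_top)

variable {L : ℝ} {m : ℕ} {n : Fin 3 → ℤ} {a b : ℝ}

/-! ## §5 LOAD-BEARING: the near-minimiser hypothesis -/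

/-- The crux with the hypothesis "`Ψ` is a `δ`-near-minimiser" DROPPED (everything else
verbatim; the now idle `∃ δ > 0` is kept). -/
def PeriodicIRBoundWithoutNearMin : Prop :=
  ∀ v : ℝ → ℝ≥0∞, IsRepulsiveFiniteRange v → ∀ κ : ℝ, 0 < κ → ∃ ρ₀ : ℝ, 0 < ρ₀ ∧ ∃ C : ℝ, 0 < C ∧
    ∀ ρ : ℝ, 0 < ρ → ρ < ρ₀ → ∀ᶠ N : ℕ in atTop, ∃ δ : ℝ≥0∞, 0 < δ ∧
      ∀ Ψ : PeriodicTrialState N (sideLength ρ N), ∀ k : Fin 3 → ℤ, k ≠ 0 →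
        ‖(fun j => (k j : ℝ))‖ ≤ κ * Real.sqrt ρ * sideLength ρ N → IRIneq C ρ N Ψ.ψ k

/-- **Load-bearing (near-minimiser).** Without the energy condition the crux is false for EVERY
admissible `v` (here `v = 0`, `κ = 1`): the boosted condensate `Ψ_1 = L^{-3N/2} ∏ⱼ e₁(xⱼ)` has
`n_{e₁} = N > C √ρ L_N` eventually. Any proof must use the near-minimiser hypothesis (a fortiori:
the bound is a statement about LOW-ENERGY states only, with energy resolution `δ_N` below the
boost cost `4π²N/L_N² = 4π²ρ L_N`, cf. barrier `KineticGapLengthScalesNarrow`). [folklore] -/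
theorem periodicIRBound_false_without_nearMin : ¬ PeriodicIRBoundWithoutNearMin := by
  intro h
  obtain ⟨ρ₀, hρ₀, C, _hC, h⟩ := h 0 isRepulsiveFiniteRange_zero 1 one_pos
  have hρ : (0 : ℝ) < ρ₀ / 2 := by positivity
  obtain ⟨N, ⟨δ, _hδ, hN⟩, hwin, hlt, hNpos⟩ :=
    ((h (ρ₀ / 2) hρ (by linarith)).and ((eventually_one_le_window hρ one_pos).and
      ((eventually_bound_lt_N hρ C).and (eventually_gt_atTop 0)))).exists
  obtain ⟨m, rfl⟩ : ∃ m, N = m + 1 := ⟨N - 1, by omega⟩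
  have hL := sideLength_pos_of_pos hρ hNpos
  have key := hN (twoMode m hL e0_ne_zero 1 zero_le_one le_rfl) e0 e0_ne_zero (by rwa [norm_e0])
  rw [irIneq_iff, cellOccupation_twoMode hL e0_ne_zero zero_le_one le_rfl, norm_e0, div_one,
    mul_one] at key
  have key' := (ENNReal.ofReal_le_ofReal_iff (by positivity)).1 key
  linarith


/-! ## §6 LOAD-BEARING: finite range (only through `E₀^{per} < ⊤`) -/

/-- The crux with `IsRepulsiveFiniteRange v` WEAKENED to `Measurable v` (everything else verbatim). -/
def PeriodicIRBoundWithoutFiniteRange : Prop :=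
  ∀ v : ℝ → ℝ≥0∞, Measurable v → IRBoundFor v

/-- **Load-bearing (finite range / finiteness of `E₀`).** For the constant potential `v ≡ 1`
(`v^{per} = ∑_{ℤ³} 1 = ⊤`) every periodic state of `N ≥ 2` particles has energy `⊤`, so
`E₀^{per} = ⊤`, EVERY state is a `δ`-near-minimiser, and the boosted condensate violates the bound.
Finite range enters the crux only through `E₀^{per}(N, L_N) < ⊤` for `ρ < ρ₀(v)` and large `N`
(in tree: `exists_eventually_periodicGroundStateEnergy_lt_top`). [folklore] -/
theorem periodicIRBound_false_without_finiteRange : ¬ PeriodicIRBoundWithoutFiniteRange := by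
  intro h
  obtain ⟨ρ₀, hρ₀, C, _hC, h⟩ := h (fun _ => 1) measurable_const 1 one_pos
  have hρ : (0 : ℝ) < ρ₀ / 2 := by positivity
  obtain ⟨N, ⟨δ, _hδ, hN⟩, hwin, hlt, hN2⟩ :=
    ((h (ρ₀ / 2) hρ (by linarith)).and ((eventually_one_le_window hρ one_pos).and
      ((eventually_bound_lt_N hρ C).and (eventually_ge_atTop 2)))).exists
  obtain ⟨m, rfl⟩ : ∃ m, N = m + 1 := ⟨N - 1, by omega⟩
  have hL := sideLength_pos_of_pos hρ (by omega : 0 < m + 1)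
  have key := hN (twoMode m hL e0_ne_zero 1 zero_le_one le_rfl)
    (by unfold NearMin; rw [periodicGroundStateEnergy_one_eq_top hN2]; exact le_top)
    e0 ⟨e0_ne_zero, by rwa [norm_e0]⟩
  rw [irIneq_iff, cellOccupation_twoMode hL e0_ne_zero zero_le_one le_rfl, norm_e0, div_one,
    mul_one] at key
  have key' := (ENNReal.ofReal_le_ofReal_iff (by positivity)).1 key
  linarith

/-! ## §7 LOAD-BEARING: diluteness (`∃ ρ₀`, `ρ < ρ₀`) — hard spheres jam at high density -/

/-- The crux asserted at EVERY density: `∀ ρ > 0, ∃ C > 0, …` in place of `∃ ρ₀, ∃ C, ∀ ρ < ρ₀`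
(the constant is even allowed to depend on `ρ`; everything else verbatim). -/
def PeriodicIRBoundAllDensities : Prop :=
  ∀ v : ℝ → ℝ≥0∞, IsRepulsiveFiniteRange v → ∀ κ : ℝ, 0 < κ → ∀ ρ : ℝ, 0 < ρ → ∃ C : ℝ, 0 < C ∧
    ∀ᶠ N : ℕ in atTop, ∃ δ : ℝ≥0∞, 0 < δ ∧ ∀ Ψ : PeriodicTrialState N (sideLength ρ N),
      NearMin v ρ N δ Ψ → ∀ k : Fin 3 → ℤ, InWindow κ ρ N k → IRIneq C ρ N Ψ.ψ k

/-- Above close packing (`ρ = 64`, hard core of radius `1`) every periodic `N`-body state on the torus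
of side `L_N` has energy `⊤`, for all `N ≥ 64`. [folklore] -/
theorem periodicEnergy_hardCore_top {N : ℕ} (hN : 64 ≤ N) :
    ∀ Ψ : PeriodicTrialState N (sideLength 64 N), periodicEnergy hardCore Ψ = ⊤ := by
  have hρ : (0 : ℝ) < 64 := by norm_num
  have hL := sideLength_pos_of_pos hρ (by omega : 0 < N)
  have hL3 : sideLength 64 N ^ 3 = (N : ℝ) / 64 := sideLength_pow_three hρ N
  set L := sideLength 64 N with hLdef
  have hNR : (64 : ℝ) ≤ N := by exact_mod_cast hN
  have hL1 : 1 ≤ L := by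
    have h1 : (1 : ℝ) ≤ L ^ 3 := by
      rw [hL3, le_div_iff₀ hρ]
      linarith
    by_contra hlt
    push Not at hlt
    have : L ^ 3 < 1 ^ 3 := pow_lt_pow_left₀ hlt hL.le (by norm_num)
    linarith
  set m : ℕ := ⌈2 * L⌉₊ with hm
  have hm2 : 2 * L ≤ m := Nat.le_ceil _
  have hmlt : (m : ℝ) < 2 * L + 1 := Nat.ceil_lt_add_one (by positivity)
  have hm3L : (m : ℝ) ≤ 3 * L := by linarith
  have hcardR : (m : ℝ) ^ 3 < (N : ℝ) := by
    have h27 : (m : ℝ) ^ 3 ≤ 27 * ((N : ℝ) / 64) := by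
      have : (m : ℝ) ^ 3 ≤ (3 * L) ^ 3 := pow_le_pow_left₀ (by positivity) hm3L 3
      rw [mul_pow, hL3] at this
      linarith
    have : 27 * ((N : ℝ) / 64) < N := by
      rw [mul_div_assoc']
      rw [div_lt_iff₀ hρ]
      linarith
    linarith
  have hcard : m ^ 3 < N := by exact_mod_cast hcardR
  exact fun Ψ => periodicEnergy_hardCore_eq_top hL hm2 hcard Ψ

/-- **Load-bearing (diluteness).** At ALL densities the crux is false, for the ADMISSIBLE hard core
of radius `1` at `ρ = 64`: no configuration of the cell avoids an encounter (pigeonhole,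
`exists_close_pair`), every energy is `⊤`, every state is a near-minimiser, and the boosted
condensate has `n_{e₁} = N`. The crux genuinely lives below close packing: any proof must use
`ρ < ρ₀(v)`. [folklore] -/
theorem periodicIRBound_false_allDensities : ¬ PeriodicIRBoundAllDensities := by
  intro h
  have hρ : (0 : ℝ) < 64 := by norm_num
  obtain ⟨C, _hC, h⟩ := h hardCore isRepulsiveFiniteRange_hardCore 1 one_pos 64 hρ
  obtain ⟨N, ⟨δ, _hδ, hN⟩, hwin, hlt, hN64⟩ :=
    (h.and ((eventually_one_le_window hρ one_pos).and
      ((eventually_bound_lt_N hρ C).and (eventually_ge_atTop 64)))).exists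
  obtain ⟨m, rfl⟩ : ∃ m, N = m + 1 := ⟨N - 1, by omega⟩
  have hL := sideLength_pos_of_pos hρ (by omega : 0 < m + 1)
  have hE0 : periodicGroundStateEnergy hardCore (m + 1) (sideLength 64 (m + 1)) = ⊤ :=
    iInf_eq_top.2 fun Ψ => periodicEnergy_hardCore_top hN64 Ψ
  have key := hN (twoMode m hL e0_ne_zero 1 zero_le_one le_rfl)
    (by unfold NearMin; rw [hE0]; exact le_top) e0 ⟨e0_ne_zero, by rwa [norm_e0]⟩
  rw [irIneq_iff, cellOccupation_twoMode hL e0_ne_zero zero_le_one le_rfl, norm_e0, div_one,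
    mul_one] at key
  have key' := (ENNReal.ofReal_le_ofReal_iff (by positivity)).1 key
  linarith

/-! ## §8 QUANTIFIER ORDER IS LOAD-BEARING: no `N`-uniform slack `δ` -/

/-- The crux with the slack chosen BEFORE `N` (`∃ δ > 0, ∀ᶠ N` in place of `∀ᶠ N, ∃ δ > 0`;
everything else verbatim). -/
def PeriodicIRBoundUniformSlack : Prop :=
  ∀ v : ℝ → ℝ≥0∞, IsRepulsiveFiniteRange v → ∀ κ : ℝ, 0 < κ → ∃ ρ₀ : ℝ, 0 < ρ₀ ∧ ∃ C : ℝ, 0 < C ∧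
    ∀ ρ : ℝ, 0 < ρ → ρ < ρ₀ → ∃ δ : ℝ≥0∞, 0 < δ ∧ ∀ᶠ N : ℕ in atTop,
      ∀ Ψ : PeriodicTrialState N (sideLength ρ N),
        NearMin v ρ N δ Ψ → ∀ k : Fin 3 → ℤ, InWindow κ ρ N k → IRIneq C ρ N Ψ.ψ k

/-- **Quantifier order (uniform slack) — FALSE already for the free gas.** With an `N`-uniform
slack `δ > 0` the window `E ≤ E₀ + δ = δ` (free gas) contains, at `L = L_N`, the two-mode state
`Ψ_t` with `t = d L²/(4π² N)` (`d = min(δ,1)`): its energy is `d ≤ δ` but its occupation of `e₁` is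
`N t = d L_N²/(4π²) ≫ C √ρ L_N`. Hence the admissible `δ_N` of the crux must shrink at least like
the kinetic gap `4π²/L_N² ∼ N^{-2/3}` (free) — the crux is a statement about the ground state at
each `N`, not about an energy window (insertion analogue: `insertionResidue_false_uniformWindow`;
barrier `KineticGapLengthScalesNarrow`). [folklore] -/
theorem periodicIRBound_false_uniformSlack : ¬ PeriodicIRBoundUniformSlack := by
  intro h
  obtain ⟨ρ₀, hρ₀, C, _hC, h⟩ := h 0 isRepulsiveFiniteRange_zero 1 one_pos
  have hρ : (0 : ℝ) < ρ₀ / 2 := by positivity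
  obtain ⟨δ, hδ, h⟩ := h (ρ₀ / 2) hρ (by linarith)
  -- a real slack `d ∈ (0, 1]` below `δ`
  set d : ℝ := (min δ 1).toReal with hd
  have hmin_ne_top : min δ 1 ≠ ⊤ := ne_top_of_le_ne_top ENNReal.one_ne_top (min_le_right _ _)
  have hd0 : 0 < d := by
    rw [hd]
    exact ENNReal.toReal_pos (lt_min hδ one_pos).ne' hmin_ne_top
  have hd1 : d ≤ 1 := by
    rw [hd]
    have := ENNReal.toReal_mono ENNReal.one_ne_top (min_le_right δ 1)
    simpa using this
  have hdδ : ENNReal.ofReal d ≤ δ := by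
    rw [hd, ENNReal.ofReal_toReal hmin_ne_top]
    exact min_le_left _ _
  have hπ : (0 : ℝ) < 4 * Real.pi ^ 2 := by positivity
  obtain ⟨N, hN, hwin, hlt, hle, hNpos⟩ :=
    (h.and ((eventually_one_le_window hρ one_pos).and
      ((eventually_bound_lt_sq hρ (div_pos hd0 hπ) C).and
        ((eventually_sq_le_N hρ (d / (4 * Real.pi ^ 2))).and (eventually_gt_atTop 0))))).exists
  obtain ⟨m, rfl⟩ : ∃ m, N = m + 1 := ⟨N - 1, by omega⟩
  have hL := sideLength_pos_of_pos hρ hNpos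
  set L := sideLength (ρ₀ / 2) (m + 1) with hLdef
  have hNR : (0 : ℝ) < ((m + 1 : ℕ) : ℝ) := by positivity
  -- the fraction `t = d L² / (4π² N) ∈ (0, 1]`
  set t : ℝ := d / (4 * Real.pi ^ 2) * L ^ 2 / ((m + 1 : ℕ) : ℝ) with ht
  have ht0 : 0 ≤ t := by positivity
  have ht1 : t ≤ 1 := by
    rw [ht, div_le_one hNR]
    exact hle
  have hNt : ((m + 1 : ℕ) : ℝ) * t = d / (4 * Real.pi ^ 2) * L ^ 2 := by
    rw [ht]; field_simp
  -- the witness is a `δ`-near-minimiser of the free gas …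
  have hnear : NearMin 0 (ρ₀ / 2) (m + 1) δ (twoMode m hL e0_ne_zero t ht0 ht1) := by
    unfold NearMin
    rw [periodicGroundStateEnergy_zero_eq_zero _ hL, zero_add,
      periodicEnergy_zero_twoMode hL e0_ne_zero ht0 ht1, nsq_e0]
    refine le_trans (le_of_eq ?_) hdδ
    congr 1
    rw [← mul_assoc, hNt]
    field_simp
  -- … violating the bound at `k = e₁`
  have key := hN (twoMode m hL e0_ne_zero t ht0 ht1) hnear e0 ⟨e0_ne_zero, by rwa [norm_e0]⟩
  rw [irIneq_iff, cellOccupation_twoMode hL e0_ne_zero ht0 ht1, norm_e0, div_one, hNt] at key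
  have key' := (ENNReal.ofReal_le_ofReal_iff (by positivity)).1 key
  linarith


end Summit.AtomisticToContinuum.BoseEinsteinCondensation.Theorems.PeriodicIRBound.Negative

end
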